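import Literature.Computability.AlgebraicComplexity.KV20EquationsPITWinWin
import Literature.Computability.AlgebraicComplexity.KV20UniversalMapInt
import Literature.Computability.AlgebraicComplexity.ConstantFreeCircuits
import Literature.Computability.AlgebraicComplexity.BurgisserBooleanPartsA3Steps
import Literature.Computability.Complexity.SearchToDecisionOracle
import Mathlib.Combinatorics.Nullstellensatz
import HarnessLib

/-!
# Kumar–Volk, Cor. 1.3 (any derandomisation of PIT yields lower bounds): the assembly of the
# printed proof, from polynomial-space equations and a certificate kit

Topic `Literature/Computability/AlgebraicComplexity`; theorem-only assembly file of the val-lit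
roster "KV20 Cor 1.3 REDUCTION" (lead-np RULINGS (105)/(106), 2026-08-27; owner x5) for the
typed fact `kumarVolk2020_cor_1_3` (`KV20EquationsPITWinWin.lean`; M. Kumar, B. L. Volk, ACM TOCT
14(2) (2022) art. 6 = arXiv:2003.12938 [KumarVolk2022], Cor. 1.3, proved in §6 = arXiv §5,
locators `[tex p0008:L1–34, p0009:L1–13]` of `lit read paper:arxiv-2003.12938`).

## The printed proof and what this file assembles

Print (p0009:L1–13): "the proof of Thm 1.2 provides an equation `Q_n` … there exists a fixed
PSPACE algorithm which, on input `1^n`, outputs the list of coefficients of `Q_n`" — (M1); "If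
for any constant `k` there exist infinitely many `n` such that `Q_n` requires circuits of size at
least `n^k` … [item (1)]. We are thus left to consider the case that … for all large enough `n`,
`Q_n` can be computed by circuits of size `n^k` … Consider the language `L` of pairs `(1^n, x)`
such that there exists a string `y` … `xy` describes an almost-MD circuit `C` such that `C` is
non-zero, and `C ∘ U ≡ 0` … Assuming PIT ∈ P, the language `L` is in NP … we can use the NP
oracle to construct such a circuit `C` bit by bit. Finally, using Lemma 15 we can output a matrix
`M` such that `C(M) ≠ 0`. By the properties of the circuit `C` and the map `U`, `M` does not have
linear circuits of size less than `n²/200`."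

This file proves `kumarVolk2020_cor_1_3` FROM
* **(M1)**, entered as a HYPOTHESIS (`hM1`, spelled inline — the cell does not type proof-internal
  claims as facts): a family `Q : ∀ m, ℤ[x_1..x_m]` of p-bounded degree whose coefficient bit
  language is in `PSPACE` and whose member `Q (n·n)` is, for large `n`, a nonzero equation of the
  INTEGER universal map `Ũ_n` of `KV20UniversalMapInt.lean` (`bind₁ (uFin n) (Q (n*n)) = 0`) — the
  "fixed PSPACE algorithm" of print, NOT formalised here (a uniform polynomial-space transducer
  with exponentially long output; programme of record, unstaffed);
* a **certificate kit** `(R, ptList)` with four properties (`hR`, `hpt`, `hsound`, `hcomplete`),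
  also entered as hypotheses of `cor_1_3_of_kit` and supplied by the roster's writer files
  (p1: `KV20UniversalMapWriter.lean`, `KV20CertificateRelation.lean`): `R ∈ P` under `PIT ∈ P`;
  membership `⟨1ⁿ, w⟩ ∈ R` certifies a polynomial `P` with `P ∘ Ũ_n = 0` and an integer point `a`
  with `P(a) ≠ 0` that `ptList` writes out as the `n × n` integer matrix (soundness); and every
  small sign-constant circuit `C` with `C ∘ Ũ_n = 0` together with a small non-root `a` HAS a
  short certificate (completeness);
and the tree's bricks: search-to-decision relative to `NP` (`searchFn_mem_FPRel`,
`searchFn_spec`, `SuffExt_mem_NP`, `SearchToDecisionOracle.lean` = the "bit by bit" oracle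
construction), the soundness of the certificate (`not_mem_smallLinCircuitSet_of_eval_ne_zero`,
`KV20UniversalMapInt.lean` = "by the properties of `C` and `U`"), attainment of `τ`
(`ArithCircuit.exists_computes_size_eq_constantFreeComplexity`) and Alon's Nullstellensatz
(Mathlib `MvPolynomial.eq_zero_of_eval_zero_at_prod_finset`: a nonzero polynomial of degree `≤ D`
has a non-root in `{0, …, D}^N`).

## DEVIATION FROM PRINT (disclosed per RULING (105)(c)(i))

Print certifies "deg `C` ≤ size" SYNTACTICALLY (Def. 13 almost-MD circuits, Lemma 14 =
Malod–Portier, p0008:L13–27) and then FINDS a non-root deterministically (Lemma 15, p0008:L28–34,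
`(s+1)·n` PIT calls). Here the non-root point is PART OF THE NP WITNESS and the verifier checks
`C(a) ≢ 0` by one more PIT call (`R` above): completeness uses the small circuit computing `Q_n`
itself plus a grid non-root (degree `≤ poly`), soundness is unchanged. Hence neither Lemma 14
(almost-MD / [MP08]) nor Lemma 15 is formalised; the statement proved is the printed Cor. 1.3.
The constant: print's "size less than `n²/200`" (edges) gives `δ = 1/200` in the typed item (2)
(`s' > ⌊n²/200⌋ ⇒ n²/200 ≤ s'`), size = number of edges in both print and `HasLinCircuit`.

## Main statements (0 facts; three plumbing defs `corSize`, `uFin`, `compMatrix`)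

* `corSize n = n² / 200`, `uFin n : Fin (n·n) → ℤ[x ⊕ y]` (row-major re-indexing of `Ũ_n`);
* `exists_equation_uFin`, `exists_equations_nonuniform` — (M1) minus its `PSPACE` clause is a
  theorem of the tree (the hypothesis asks for the uniformity only);
* `exists_grid_eval_ne_zero` — non-roots in `{0..D}^N` (Nullstellensatz);
* `cor_1_3_of_kit` — `kumarVolk2020_cor_1_3` from (M1) and a certificate kit;
* `compMatrix`, `coeff_bind₁_eq_sum`, `bind₁_eq_zero_iff_linearSystem`, `coeff_bind₁_eq_zero_of_lt`
  — the linear system `Q ∘ Ũ = 0` in coordinates (the object (M1) solves; generic in the map).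

Honest framing (val-lit): bookkeeping of a published CONDITIONAL result ("PIT ∈ P ⇒ one of two
lower bounds"); census +0 (the fact stays open until (M1) is proved); nothing here bears on
`VP ≠ VNP`, which is NOT proved.

## References

* [KumarVolk2022] M. Kumar, B. L. Volk, ACM TOCT 14(2) (2022) art. 6 = arXiv:2003.12938, Cor. 1.3
  and §6 (= arXiv Cor. 3, §5: Def. 13, Lemmas 14–15, proof of Cor. 3).
* [AroraBarak2009] S. Arora, B. Barak, *Computational Complexity*, CUP 2009, Thm. 2.18 (proof),
  §3.4 (search with an oracle).
* N. Alon, *Combinatorial Nullstellensatz* (1999), Thm. 1.2 — Mathlib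
  `MvPolynomial.eq_zero_of_eval_zero_at_prod_finset`.
-/

noncomputable section

open MvPolynomial

namespace Literature.Computability.AlgebraicComplexity

open Literature.Computability.Complexity _root_.Computability

namespace KumarVolk2020

/-! ### The parameters of the proof -/

/-- The size parameter of the proof of Cor. 1.3: `s_n = ⌊n²/200⌋` ("the map `U` given in the
proof of Thm 1.2", `s = n²/200`). [cite: KumarVolk2022, §6 (proof of Cor. 1.3)] -/
def corSize (n : ℕ) : ℕ := n ^ 2 / 200

/-- `200 · s_n ≤ n²`. [cite: KumarVolk2022, §6 (proof of Cor. 1.3)] -/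
theorem corSize_spec (n : ℕ) : 200 * corSize n ≤ n ^ 2 := by
  unfold corSize; omega

/-- **The integer universal map `Ũ_n` on row-major indices**: coordinate `q = j + n·i` of
`Fin (n·n)` is entry `(i, j)` (`finProdFinEquiv`), size `s_n`. [cite: KumarVolk2022, §6 (proof of Cor. 1.3)] -/
def uFin (n : ℕ) (q : Fin (n * n)) : MvPolynomial (Fin (corSize n) ⊕ Fin (corSize n)) ℤ :=
  universalMapInt n (corSize n) (finProdFinEquiv.symm q)

/-- `Ũ_n` on pairs is `uFin n` re-indexed: `bind₁ Ũ (rename e⁻¹ P) = bind₁ (uFin n) P`.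
[cite: KumarVolk2022, §6 (proof of Cor. 1.3)] -/
theorem bind₁_universalMapInt_rename (n : ℕ) (P : MvPolynomial (Fin (n * n)) ℤ) :
    bind₁ (universalMapInt n (corSize n)) (rename finProdFinEquiv.symm P) = bind₁ (uFin n) P := by
  rw [bind₁_rename]; rfl

/-! ### The hypothesis (M1) minus its complexity clause is a theorem (non-vacuity) -/

/-- For `n ≥ 1`, a nonzero integer equation of degree `≤ n³` for `Ũ_n` on row-major indices
(`exists_int_equation_universalMapInt` re-indexed). [cite: KumarVolk2022, Thm. 1.2 (proof, §4.2)] -/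
theorem exists_equation_uFin {n : ℕ} (hn : 1 ≤ n) :
    ∃ Q : MvPolynomial (Fin (n * n)) ℤ, Q ≠ 0 ∧ Q.totalDegree ≤ n ^ 3 ∧ bind₁ (uFin n) Q = 0 := by
  obtain ⟨Q, hQ0, hdeg, hU⟩ := exists_int_equation_universalMapInt hn (corSize_spec n)
  refine ⟨rename finProdFinEquiv Q, fun h => hQ0 (rename_injective _ finProdFinEquiv.injective
    (by rw [h, map_zero])), (totalDegree_rename_le _ _).trans hdeg, ?_⟩
  rw [← bind₁_universalMapInt_rename, rename_rename]
  have : (finProdFinEquiv.symm ∘ finProdFinEquiv : Fin n × Fin n → Fin n × Fin n) = id :=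
    funext fun q => finProdFinEquiv.symm_apply_apply q
  rw [this, rename_id]
  exact hU

/-- **(M1) without its `PSPACE` clause holds**: there IS a family `Q : ∀ m, ℤ[x_1..x_m]` of
p-bounded degree with `Q (n·n)` a nonzero equation of `Ũ_n` for every `n ≥ 1` (non-uniformly
chosen, `exists_equation_uFin` at `m = n²`, `0` at non-squares). So the hypothesis `hM1` of
`cor_1_3_of_kit` asks exactly for the printed "fixed PSPACE algorithm which, on input `1^n`,
outputs the list of coefficients of `Q_n`" — the uniformity, not the algebra.
[cite: KumarVolk2022, §6 (proof of Cor. 1.3: "This polynomial can be found by solving a linear system …")] -/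
theorem exists_equations_nonuniform :
    ∃ Q : ∀ m, MvPolynomial (Fin m) ℤ, IsPBounded (fun m => (Q m).totalDegree) ∧
      ∃ n₀ : ℕ, ∀ n, n₀ ≤ n → Q (n * n) ≠ 0 ∧ bind₁ (uFin n) (Q (n * n)) = 0 := by
  classical
  -- the chosen equation at each `k ≥ 1`
  let Qf : ∀ k, MvPolynomial (Fin (k * k)) ℤ := fun k =>
    if hk : 1 ≤ k then Classical.choose (exists_equation_uFin hk) else 0
  have hQf : ∀ k, 1 ≤ k → Qf k ≠ 0 ∧ (Qf k).totalDegree ≤ k ^ 3 ∧ bind₁ (uFin k) (Qf k) = 0 := by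
    intro k hk
    simp only [Qf, dif_pos hk]
    exact Classical.choose_spec (exists_equation_uFin hk)
  have hQfdeg : ∀ k, (Qf k).totalDegree ≤ k ^ 3 := by
    intro k
    by_cases hk : 1 ≤ k
    · exact (hQf k hk).2.1
    · simp only [Qf, dif_neg hk, totalDegree_zero]; exact Nat.zero_le _
  -- transport to `Fin m` along `m = (√m)²` at perfect squares
  let Q : ∀ m, MvPolynomial (Fin m) ℤ := fun m =>
    if h : Nat.sqrt m * Nat.sqrt m = m then rename (Fin.cast h) (Qf (Nat.sqrt m)) else 0
  have hsq : ∀ n, Q (n * n) = Qf n := by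
    intro n
    have key : ∀ k, k = n → ∀ h : k * k = n * n, rename (Fin.cast h) (Qf k) = Qf n := by
      rintro k rfl h
      have hc : (Fin.cast h : Fin (k * k) → Fin (k * k)) = id := funext fun i => Fin.ext rfl
      rw [hc, rename_id]
      rfl
    simp only [Q, dif_pos (show Nat.sqrt (n * n) * Nat.sqrt (n * n) = n * n by rw [Nat.sqrt_eq])]
    exact key _ (Nat.sqrt_eq n) _
  refine ⟨Q, ⟨2, fun m => ?_⟩, 1, fun n hn => ?_⟩
  · by_cases h : Nat.sqrt m * Nat.sqrt m = m
    · simp only [Q, dif_pos h]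
      refine (totalDegree_rename_le _ _).trans ((hQfdeg _).trans ?_)
      set k := Nat.sqrt m
      rw [← h]
      rcases Nat.eq_zero_or_pos k with hk | hk
      · rw [hk]; simp
      · calc k ^ 3 ≤ k ^ 3 * k := Nat.le_mul_of_pos_right _ hk
          _ = (k * k) ^ 2 := by ring
          _ ≤ (k * k) ^ 2 + 2 := Nat.le_add_right _ _
    · simp only [Q, dif_neg h, totalDegree_zero]; exact Nat.zero_le _
  · rw [hsq]
    exact ⟨(hQf n hn).1, (hQf n hn).2.2⟩

/-! ### Non-roots on a grid (Alon) -/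

/-- **A nonzero integer polynomial of total degree `≤ D` has a non-root in `{0, …, D}^N`**
(Combinatorial Nullstellensatz, Mathlib `eq_zero_of_eval_zero_at_prod_finset`, with
`degreeOf ≤ totalDegree`). [cite: KumarVolk2022, Lemma 15 (proof: "there exists a_1 ∈ {0,1,…,s} …")] -/
theorem exists_grid_eval_ne_zero {N : ℕ} (P : MvPolynomial (Fin N) ℤ) (hP : P ≠ 0) {D : ℕ}
    (hD : P.totalDegree ≤ D) :
    ∃ a : Fin N → ℤ, (∀ q, 0 ≤ a q ∧ a q ≤ D) ∧ eval a P ≠ 0 := by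
  classical
  by_contra h
  push Not at h
  apply hP
  refine eq_zero_of_eval_zero_at_prod_finset P
    (fun _ => (Finset.range (D + 1)).image (Nat.cast : ℕ → ℤ)) (fun i => ?_) (fun x hx => ?_)
  · rw [Finset.card_image_of_injective _ Nat.cast_injective, Finset.card_range]
    exact lt_of_le_of_lt (degreeOf_le_totalDegree P i) (Nat.lt_succ_of_le hD)
  · refine h x fun q => ?_
    obtain ⟨k, hk, hkx⟩ := Finset.mem_image.1 (hx q)
    rw [← hkx]
    exact ⟨Int.natCast_nonneg k, Int.ofNat_le.2 (Nat.lt_succ_iff.1 (Finset.mem_range.1 hk))⟩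

/-! ### Small lemmas -/

/-- `|1ⁿ| = n`. [folklore] -/
private theorem length_unaryEncodeNat (n : ℕ) : (unaryEncodeNat n).length = n := by
  induction n with
  | zero => rfl
  | succ n ih => simp [unaryEncodeNat, ih]

/-- `HasLinCircuit` is monotone in the size bound. [cite: KumarVolk2022, §1.3] -/
private theorem hasLinCircuit_mono {F : Type*} [Field F] {n s s' : ℕ} (h : s' ≤ s)
    {A : Matrix (Fin n) (Fin n) F} (hA : HasLinCircuit F s' A) : HasLinCircuit F s A := by
  obtain ⟨m, C, hsz, hC⟩ := hA
  exact ⟨m, C, hsz.trans h, hC⟩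

/-- The matrix written by `intMatrixOfList` from `List.ofFn a` (row-major) is the point
`(i, j) ↦ a (j + n i)` read in `ℂ`. [cite: KumarVolk2022, Cor. 1.3 (item 2)] -/
private theorem intMatrixOfList_ofFn {n : ℕ} (a : Fin (n * n) → ℤ) :
    intMatrixOfList n (List.ofFn a) =
      matrixOfPt ℂ fun p : Fin n × Fin n => ((a (finProdFinEquiv p) : ℤ) : ℂ) := by
  ext i j
  rw [matrixOfPt_apply]
  unfold intMatrixOfList
  have hlt : i.1 * n + j.1 < n * n := by
    have := (finProdFinEquiv (i, j)).isLt
    simp only [finProdFinEquiv, Equiv.coe_fn_mk] at this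
    linarith [this, Nat.mul_comm n i.1]
  have hidx : (⟨i.1 * n + j.1, hlt⟩ : Fin (n * n)) = finProdFinEquiv (i, j) := by
    ext; simp only [finProdFinEquiv, Equiv.coe_fn_mk, Fin.val_mk]; ring
  congr 1
  rw [List.getD_eq_getElem?_getD, List.getElem?_ofFn, dif_pos hlt, Option.getD_some, hidx]

/-! ### The assembly -/

/-- **Kumar–Volk Cor. 1.3 from polynomial-space equations and a certificate kit.** Hypotheses:
`hM1` = the printed "fixed PSPACE algorithm … outputs the list of coefficients of `Q_n`" together
with "`Q_n` is an equation of degree `poly(n)`" for the INTEGER universal map (M1 of the roster,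
not formalised); `(R, ptList)` with `hR` ("Assuming PIT ∈ P, the language … is in NP": the
verifier relation is in `P`), `hpt` (the output writer is polynomial time), `hsound` (a certified
witness yields `P` with `P ∘ Ũ_n = 0`, `P(a) ≠ 0`, and the written matrix is `a`), `hcomplete`
(small sign-constant equations with small non-roots have short certificates). Then: case
`¬ IsPBounded (τ ∘ Q)` gives item (1) with `Q` itself; otherwise item (2) with
`L = SuffExt R p ∈ NP`, `f = x ↦ ptList ⟨x, searchFn R p x⟩ ∈ FP^L` and `δ = 1/200`.
DEVIATION FROM PRINT: the non-root point is part of the certificate (module docstring); KV's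
Lemmas 14–15 are not used. [cite: KumarVolk2022, Cor. 1.3 (proof, §6 = arXiv §5 p0009:L1–13)] -/
theorem cor_1_3_of_kit (R : Language Bool) (ptList : List Bool → List Bool)
    (hR : PITLanguage ∈ Classes.P → R ∈ Classes.P) (hpt : ptList ∈ FP)
    (hsound : ∀ (n : ℕ) (w : List Bool), boolPair (unaryEncodeNat n) w ∈ R →
      ∃ (P : MvPolynomial (Fin (n * n)) ℤ) (a : Fin (n * n) → ℤ),
        bind₁ (uFin n) P = 0 ∧ eval a P ≠ 0 ∧
        encodingIntBool.listBool.decode (ptList (boolPair (unaryEncodeNat n) w)) =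
          some (List.ofFn a))
    (hcomplete : ∃ c₀ : ℕ, ∀ (n : ℕ) (C : ArithCircuit ℤ (Fin (n * n))) (a : Fin (n * n) → ℤ)
      (A : ℕ), C.IsFanInTwo → C.HasSignConstants → bind₁ (uFin n) C.eval = 0 → eval a C.eval ≠ 0 →
      (∀ q, 0 ≤ a q ∧ a q ≤ A) →
      ∃ w : List Bool, w.length ≤ (n + C.size + A) ^ c₀ + c₀ ∧ boolPair (unaryEncodeNat n) w ∈ R)
    (hM1 : ∃ Q : ∀ m, MvPolynomial (Fin m) ℤ,
      coeffBitLanguage Q ∈ PSPACE ∧ IsPBounded (fun m => (Q m).totalDegree) ∧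
        ∃ n₀ : ℕ, ∀ n, n₀ ≤ n → Q (n * n) ≠ 0 ∧ bind₁ (uFin n) (Q (n * n)) = 0) :
    kumarVolk2020_cor_1_3 := by
  classical
  intro hPIT
  obtain ⟨Q, hQps, hQdeg, n₀, hQeq⟩ := hM1
  by_cases hb : IsPBounded fun m => constantFreeComplexity (Q m)
  swap
  · exact Or.inl ⟨Q, hQdeg, hQps, hb⟩
  right
  obtain ⟨c, hc⟩ := hb
  obtain ⟨d, hd⟩ := hQdeg
  obtain ⟨c₀, hcomp⟩ := hcomplete
  have hRP : R ∈ Classes.P := hR hPIT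
  -- the witness-length polynomial
  let p : Polynomial ℕ :=
    (Polynomial.X + ((Polynomial.X ^ 2) ^ c + Polynomial.C c) +
      ((Polynomial.X ^ 2) ^ d + Polynomial.C d)) ^ c₀ + Polynomial.C c₀
  have hp : ∀ n : ℕ, p.eval n = (n + ((n ^ 2) ^ c + c) + ((n ^ 2) ^ d + d)) ^ c₀ + c₀ := fun n => by
    simp only [p, Polynomial.eval_add, Polynomial.eval_pow, Polynomial.eval_X, Polynomial.eval_C]
  refine ⟨SuffExt R p, SuffExt_mem_NP R p hRP,
    fun x => ptList (boolPair x (searchFn R p x)),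
    postPre_mem_FPRel (searchFn_mem_FPRel R p hRP) (PolyTimeComputable.id _) hpt,
    (1 / 200 : ℝ), by norm_num, n₀, fun n hn => ?_⟩
  obtain ⟨hQne, hQU⟩ := hQeq n hn
  -- an honest small circuit for `Q (n·n)` and a grid non-root
  obtain ⟨C, hC2, hCs, hCcomp, hCsize⟩ :=
    ArithCircuit.exists_computes_size_eq_constantFreeComplexity (Q (n * n))
  have hCeval : C.eval = Q (n * n) := hCcomp
  obtain ⟨a, ha, hane⟩ := exists_grid_eval_ne_zero (Q (n * n)) hQne (hd (n * n))
  -- its certificate, and the length bound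
  obtain ⟨w, hwlen, hwR⟩ := hcomp n C a ((n * n) ^ d + d) hC2 hCs (by rw [hCeval]; exact hQU)
    (by rw [hCeval]; exact hane) ha
  have hx : ∃ y : List Bool, y.length ≤ p.eval (unaryEncodeNat n).length ∧
      boolPair (unaryEncodeNat n) y ∈ R := by
    refine ⟨w, ?_, hwR⟩
    rw [length_unaryEncodeNat, hp]
    have hsz : C.size ≤ (n ^ 2) ^ c + c := by rw [hCsize, sq]; exact hc (n * n)
    have hA : (n * n) ^ d + d ≤ (n ^ 2) ^ d + d := by rw [sq]
    calc w.length ≤ (n + C.size + ((n * n) ^ d + d)) ^ c₀ + c₀ := hwlen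
      _ ≤ (n + ((n ^ 2) ^ c + c) + ((n ^ 2) ^ d + d)) ^ c₀ + c₀ :=
        Nat.add_le_add_right (Nat.pow_le_pow_left (by omega) _) _
  -- the oracle search returns SOME certified witness; read off its point
  obtain ⟨-, hgR⟩ := searchFn_spec R p (unaryEncodeNat n) hx
  obtain ⟨P, a', hPU, hPa, hdec⟩ := hsound n _ hgR
  refine ⟨List.ofFn a', hdec, by rw [List.length_ofFn, sq], fun s' hs' => ?_⟩
  -- soundness: the written matrix is outside the image of `Ũ_n`, so `s' > n²/200`
  set M : Fin n × Fin n → ℤ := fun q => a' (finProdFinEquiv q) with hM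
  have hP'U : bind₁ (universalMapInt n (corSize n)) (rename finProdFinEquiv.symm P) = 0 := by
    rw [bind₁_universalMapInt_rename, hPU]
  have hP'M : eval M (rename finProdFinEquiv.symm P) ≠ 0 := by
    rw [eval_rename]
    have : (M ∘ finProdFinEquiv.symm) = a' := funext fun q => by
      simp only [hM, Function.comp_apply, Equiv.apply_symm_apply]
    rwa [this]
  have hnot := not_mem_smallLinCircuitSet_of_eval_ne_zero ℂ hP'U hP'M
  have hlt : corSize n < s' := by
    by_contra hle
    push Not at hle
    refine hnot ?_
    show HasLinCircuit ℂ (corSize n) (matrixOfPt ℂ fun p : Fin n × Fin n => ((M p : ℤ) : ℂ))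
    rw [← intMatrixOfList_ofFn a']
    exact hasLinCircuit_mono hle hs'
  have h200 : n ^ 2 < s' * 200 := (Nat.div_lt_iff_lt_mul (by norm_num)).1 hlt
  have hreal : ((n : ℝ)) ^ 2 < (s' : ℝ) * 200 := by exact_mod_cast h200
  linarith

/-! ### The linear system behind (M1): `Q ∘ Ũ_n = 0` in coordinates

"This polynomial can be found by solving a linear system of equations in a linear space whose
dimension is `exp(poly(n))`" (p0009:L1–2): the map `Q ↦ Q ∘ Ũ_n` is linear in the coefficient
vector of `Q`; its matrix has the entry `coeff_β (∏_p Ũ_p^{α_p})` in row `β` (a monomial in the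
`2s` variables) and column `α` (a monomial in the `n²` entries). These lemmas are the dictionary
the M1 transducer's correctness will use (generic in the polynomial map). -/

section LinearSystem

variable {σ τ : Type*} {R : Type*} [CommSemiring R]

/-- The matrix of the composition map `Q ↦ Q ∘ f` on coefficient vectors: entry `(β, α)` is the
coefficient of `y^β` in `∏_p f_p^{α_p}`. [cite: KumarVolk2022, Lemma 2.1 (proof: "the composition Q ↦ Q ∘ P maps … linearly")] -/
def compMatrix (f : σ → MvPolynomial τ R) (β : τ →₀ ℕ) (α : σ →₀ ℕ) : R :=
  coeff β (∏ p ∈ α.support, f p ^ α p)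

/-- **Coefficients of a composition are the linear system's rows**:
`coeff_β (Q ∘ f) = Σ_{α ∈ supp Q} coeff_α Q · compMatrix f β α`.
[cite: KumarVolk2022, Lemma 2.1 (proof)] -/
theorem coeff_bind₁_eq_sum (f : σ → MvPolynomial τ R) (Q : MvPolynomial σ R) (β : τ →₀ ℕ) :
    coeff β (bind₁ f Q) = ∑ α ∈ Q.support, coeff α Q * compMatrix f β α := by
  classical
  conv_lhs => rw [Q.as_sum]
  rw [map_sum, coeff_sum]
  refine Finset.sum_congr rfl fun α _ => ?_
  rw [bind₁_monomial, coeff_C_mul, compMatrix]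

/-- **`Q ∘ f = 0` is the homogeneous linear system** `∀ β, Σ_α compMatrix f β α · coeff_α Q = 0`
in the unknowns `coeff_α Q` — for `f = uFin n` the system (M1) solves in polynomial space.
[cite: KumarVolk2022, §6 (proof of Cor. 1.3: "found by solving a linear system of equations")] -/
theorem bind₁_eq_zero_iff_linearSystem (f : σ → MvPolynomial τ R) (Q : MvPolynomial σ R) :
    bind₁ f Q = 0 ↔ ∀ β : τ →₀ ℕ, ∑ α ∈ Q.support, compMatrix f β α * coeff α Q = 0 := by
  rw [MvPolynomial.ext_iff]
  refine forall_congr' fun β => ?_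
  rw [coeff_bind₁_eq_sum, coeff_zero]
  simp only [mul_comm (coeff _ Q)]

/-- Only the rows `β` of degree `≤ (deg Q) · D` matter when every `f_p` has degree `≤ D`: higher
rows vanish identically (`totalDegree` of the composition). [cite: KumarVolk2022, Lemma 2.1 (proof: "maps F[y]_{≤Δ} into F[x]_{≤DΔ}")] -/
theorem coeff_bind₁_eq_zero_of_lt {D : ℕ} (f : σ → MvPolynomial τ R) (hf : ∀ p, (f p).totalDegree ≤ D)
    (Q : MvPolynomial σ R) {β : τ →₀ ℕ} (hβ : Q.totalDegree * D < β.sum fun _ e => e) :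
    coeff β (bind₁ f Q) = 0 := by
  classical
  have hdeg : (bind₁ f Q).totalDegree ≤ Q.totalDegree * D := by
    rw [← aeval_eq_bind₁]
    exact Literature.RingTheory.Nullstellensatz.totalDegree_aeval_le f hf Q
  by_contra h
  have hmem : β ∈ (bind₁ f Q).support := mem_support_iff.2 h
  have := le_totalDegree hmem
  omega

end LinearSystem

/-! ## Heights: the universal map has coefficients of polynomial bit-size ((P4) of the M1 programme)

"Using standard, small space algorithm for linear algebra [BvzGH82, ABO99] …" (p0009:L2) needs the
linear system behind `Q ∘ Ũ_n = 0` to have integer entries of bit-size `poly(n)`. We measure an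
integer polynomial by its Bürgisser *weight* `wt` (`Σ |coeff|`, the tree's
`Literature.Computability.AlgebraicComplexity.weight`) and prove, by the evident induction over the
universal circuit with polynomial edge labels (`weight_ucValN_le`, `weight_ucOut_le`), that every
entry of the integer universal map satisfies `wt(Ũ) ≤ ((s+1)²·(S+1)^S)^{s+1} ≤ 2^{(s+1)(2s+S²)}`,
`S = |USlot n s| = sn + s² + n(n+s)` (`weight_universalMapInt_le(_two_pow)`), the labels being the
Lagrange interpolants `svMapInt (slotNode n s)` through the nodes `0, …, S-1`
(`weight_svMapInt_slotNode_le`). With `|f(z)| ≤ wt(f)·(M+1)^{deg f}` on integer points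
`|z_v| ≤ M` (`natAbs_eval_le_weight_mul_pow`) this bounds every product of evaluations
`∏_p Ũ_p(z)^{α_p}` by `2^{poly(n)·|α|}` (`natAbs_evalEntry_uFin_le` below). -/

section Heights

variable {σ : Type*}

/-- `wt(f^k) ≤ wt(f)^k` ("the weight is submultiplicative"). [cite: Burgisser2000TCS, §2 p. 76] -/
theorem weight_pow_le (f : MvPolynomial σ ℤ) (k : ℕ) : weight (f ^ k) ≤ weight f ^ k := by
  induction k with
  | zero => simp
  | succ k ih =>
    rw [pow_succ, pow_succ]
    exact (weight_mul_le _ _).trans (Nat.mul_le_mul_right _ ih)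

/-- `wt(X_v − c) ≤ |c| + 1`. [cite: Burgisser2000TCS, §2 p. 76] -/
theorem weight_X_sub_C_le (v : σ) (c : ℤ) :
    weight (X v - C c : MvPolynomial σ ℤ) ≤ c.natAbs + 1 := by
  rw [sub_eq_add_neg, ← C_neg]
  refine (weight_add_le _ _).trans ?_
  rw [weight_X, weight_C, Int.natAbs_neg, add_comm]

variable {ι τ : Type*} [Fintype ι] [DecidableEq ι]

/-- `wt(∏_{i' ≠ i} (y_v − α_{i'})) ≤ (A+1)^{|ι|-1}` for nodes `|α_{i'}| ≤ A`.
[cite: KumarVolk2022, Lemma 3.1 (proof, Lagrange interpolation)] -/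
theorem weight_lagrangeNumerator_le (a : ι → ℤ) {A : ℕ} (ha : ∀ i, (a i).natAbs ≤ A) (i : ι)
    (v : τ) : weight (lagrangeNumerator a i v) ≤ (A + 1) ^ (Fintype.card ι - 1) := by
  unfold lagrangeNumerator
  calc weight (∏ i' ∈ Finset.univ.erase i, (X v - C (a i') : MvPolynomial τ ℤ))
      ≤ ∏ i' ∈ Finset.univ.erase i, weight (X v - C (a i') : MvPolynomial τ ℤ) :=
        weight_finset_prod_le _ _
    _ ≤ ∏ _i' ∈ Finset.univ.erase i, (A + 1) :=
        Finset.prod_le_prod (fun _ _ => Nat.zero_le _) fun i' _ =>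
          (weight_X_sub_C_le v (a i')).trans (Nat.add_le_add_right (ha i') 1)
    _ = (A + 1) ^ (Fintype.card ι - 1) := by
        rw [Finset.prod_const, Finset.card_erase_of_mem (Finset.mem_univ i), Finset.card_univ]

/-- `wt(L_i) ≤ k·(A+1)^{|ι|-1}` for the slot interpolant `L_i = Σ_j N_i(y_j)·x_j`.
[cite: KumarVolk2022, Lemma 3.1 (proof)] -/
theorem weight_svMapInt_le (a : ι → ℤ) {A : ℕ} (ha : ∀ i, (a i).natAbs ≤ A) (k : ℕ) (i : ι) :
    weight (svMapInt a k i) ≤ k * (A + 1) ^ (Fintype.card ι - 1) := by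
  unfold svMapInt
  refine (weight_finset_sum_le _ _).trans ?_
  calc ∑ j : Fin k, weight (lagrangeNumerator a i (Sum.inr j) * X (Sum.inl j))
      ≤ ∑ _j : Fin k, (A + 1) ^ (Fintype.card ι - 1) :=
        Finset.sum_le_sum fun j _ => (weight_mul_le _ _).trans (by
          rw [weight_X, mul_one]; exact weight_lagrangeNumerator_le a ha i _)
    _ = k * (A + 1) ^ (Fintype.card ι - 1) := by
        rw [Finset.sum_const, Finset.card_univ, Fintype.card_fin, smul_eq_mul]

/-- The interpolation nodes of `Ũ` are `0, …, S − 1`, `S = |USlot n s|`.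
[cite: KumarVolk2022, Thm. 1.2 (proof, §4.2)] -/
theorem natAbs_slotNode_le (n s : ℕ) (e : USlot n s) :
    (slotNode n s e).natAbs ≤ Fintype.card (USlot n s) - 1 := by
  rw [slotNode_apply, Int.natAbs_natCast, card_uSlot]
  have := (slotEquiv n s e).isLt
  omega

/-- `wt(label of Ũ at slot e) ≤ (s+1)·(S+1)^S`, `S = |USlot n s|`.
[cite: KumarVolk2022, Thm. 1.2 (proof, §4.2)] -/
theorem weight_svMapInt_slotNode_le (n s : ℕ) (e : USlot n s) :
    weight (svMapInt (slotNode n s) s e) ≤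
      (s + 1) * (Fintype.card (USlot n s) + 1) ^ Fintype.card (USlot n s) := by
  refine (weight_svMapInt_le (slotNode n s) (natAbs_slotNode_le n s) s e).trans ?_
  calc s * (Fintype.card (USlot n s) - 1 + 1) ^ (Fintype.card (USlot n s) - 1)
      ≤ s * (Fintype.card (USlot n s) + 1) ^ (Fintype.card (USlot n s) - 1) :=
        Nat.mul_le_mul_left _ (Nat.pow_le_pow_left (by omega) _)
    _ ≤ (s + 1) * (Fintype.card (USlot n s) + 1) ^ Fintype.card (USlot n s) :=
        Nat.mul_le_mul (Nat.le_succ s)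
          (Nat.pow_le_pow_right (Nat.succ_pos _) (Nat.sub_le _ 1))

variable {n s : ℕ}

/-- `wt(if c then p else 0) ≤ wt(p)` (plumbing). [folklore] -/
private theorem weight_ite_le (c : Prop) [Decidable c] (p : MvPolynomial σ ℤ) :
    weight (if c then p else 0) ≤ weight p := by
  split_ifs
  · exact le_rfl
  · rw [weight_zero]; exact Nat.zero_le _

/-- **Weight of the universal circuit's gate values** with polynomial edge labels of weight `≤ W`
(`W ≥ 1`): after `k` rounds, `wt(val) ≤ ((s+1)·W)^k` (`val(t)_i = L(X_i→t) + Σ_{t'<t} L(t'→t)·val(t')_i`).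
[cite: KumarVolk2022, §4.1] -/
theorem weight_ucValN_le (L : USlot n s → MvPolynomial σ ℤ) {W : ℕ} (hW : 1 ≤ W)
    (hL : ∀ e, weight (L e) ≤ W) :
    ∀ (k : ℕ) (t : Fin s) (i : Fin n), weight (ucValN L k t i) ≤ ((s + 1) * W) ^ k := by
  intro k
  induction k with
  | zero => intro t i; simp [ucValN]
  | succ k ih =>
    intro t i
    change weight (L (Sum.inl (t, i)) + ∑ t' : Fin s,
        (if t' < t then L (Sum.inr (Sum.inl (t, t'))) * ucValN L k t' i else 0)) ≤ _
    have hB : 1 ≤ ((s + 1) * W) ^ k := Nat.one_le_pow _ _ (Nat.mul_pos (Nat.succ_pos s) hW)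
    have h1 : weight (L (Sum.inl (t, i))) ≤ W * ((s + 1) * W) ^ k :=
      (hL _).trans (Nat.le_mul_of_pos_right _ hB)
    have h2 : weight (∑ t' : Fin s,
        (if t' < t then L (Sum.inr (Sum.inl (t, t'))) * ucValN L k t' i else 0)) ≤
        s * (W * ((s + 1) * W) ^ k) := by
      refine (weight_finset_sum_le _ _).trans ?_
      calc ∑ t' : Fin s,
            weight (if t' < t then L (Sum.inr (Sum.inl (t, t'))) * ucValN L k t' i else 0)
          ≤ ∑ _t' : Fin s, W * ((s + 1) * W) ^ k :=
            Finset.sum_le_sum fun t' _ => (weight_ite_le _ _).trans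
              ((weight_mul_le _ _).trans (Nat.mul_le_mul (hL _) (ih t' i)))
        _ = s * (W * ((s + 1) * W) ^ k) := by
            rw [Finset.sum_const, Finset.card_univ, Fintype.card_fin, smul_eq_mul]
    refine (weight_add_le _ _).trans ?_
    calc _ ≤ W * ((s + 1) * W) ^ k + s * (W * ((s + 1) * W) ^ k) := Nat.add_le_add h1 h2
      _ = ((s + 1) * W) ^ (k + 1) := by ring

/-- `wt(val(t)_i) ≤ ((s+1)·W)^s`. [cite: KumarVolk2022, §4.1] -/
theorem weight_ucVal_le (L : USlot n s → MvPolynomial σ ℤ) {W : ℕ} (hW : 1 ≤ W)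
    (hL : ∀ e, weight (L e) ≤ W) (t : Fin s) (i : Fin n) :
    weight (ucVal L t i) ≤ ((s + 1) * W) ^ s :=
  weight_ucValN_le L hW hL s t i

/-- **`wt(output entry of the universal circuit) ≤ ((s+1)·W)^{s+1}`** for edge labels of weight
`≤ W`. [cite: KumarVolk2022, §4.1] -/
theorem weight_ucOut_le (L : USlot n s → MvPolynomial σ ℤ) {W : ℕ} (hW : 1 ≤ W)
    (hL : ∀ e, weight (L e) ≤ W) (j i : Fin n) :
    weight (ucOut L j i) ≤ ((s + 1) * W) ^ (s + 1) := by
  unfold ucOut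
  have hB : 1 ≤ ((s + 1) * W) ^ s := Nat.one_le_pow _ _ (Nat.mul_pos (Nat.succ_pos s) hW)
  refine (weight_add_le _ _).trans ?_
  have h1 : weight (L (Sum.inr (Sum.inr (j, Sum.inl i)))) ≤ W * ((s + 1) * W) ^ s :=
    (hL _).trans (Nat.le_mul_of_pos_right _ hB)
  have h2 : weight (∑ t : Fin s, L (Sum.inr (Sum.inr (j, Sum.inr t))) * ucVal L t i) ≤
      s * (W * ((s + 1) * W) ^ s) := by
    refine (weight_finset_sum_le _ _).trans ?_
    calc ∑ t : Fin s, weight (L (Sum.inr (Sum.inr (j, Sum.inr t))) * ucVal L t i)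
        ≤ ∑ _t : Fin s, W * ((s + 1) * W) ^ s :=
          Finset.sum_le_sum fun t _ =>
            (weight_mul_le _ _).trans (Nat.mul_le_mul (hL _) (weight_ucVal_le L hW hL t i))
      _ = s * (W * ((s + 1) * W) ^ s) := by
          rw [Finset.sum_const, Finset.card_univ, Fintype.card_fin, smul_eq_mul]
  calc _ ≤ W * ((s + 1) * W) ^ s + s * (W * ((s + 1) * W) ^ s) := Nat.add_le_add h1 h2
    _ = ((s + 1) * W) ^ (s + 1) := by ring

/-- **The integer universal map has weight `≤ ((s+1)²·(S+1)^S)^{s+1}`**, `S = |USlot n s|`: its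
coefficients have `poly(n, s)` bits (the "issues related to the bit complexity of the constants",
p0009:L15, are only this). [cite: KumarVolk2022, Thm. 1.2 (proof, §4.2) + §6 (proof of Cor. 1.3)] -/
theorem weight_universalMapInt_le (n s : ℕ) (p : Fin n × Fin n) :
    weight (universalMapInt n s p) ≤
      ((s + 1) * ((s + 1) * (Fintype.card (USlot n s) + 1) ^ Fintype.card (USlot n s))) ^
        (s + 1) := by
  unfold universalMapInt
  exact weight_ucOut_le _ (Nat.mul_pos (Nat.succ_pos s) (Nat.one_le_pow _ _ (Nat.succ_pos _)))
    (weight_svMapInt_slotNode_le n s) p.1 p.2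

/-- Bit-size form: **`wt(Ũ entry) ≤ 2^{(s+1)(2s+S²)}`**, `S = |USlot n s|`.
[cite: KumarVolk2022, §6 (proof of Cor. 1.3)] -/
theorem weight_universalMapInt_le_two_pow (n s : ℕ) (p : Fin n × Fin n) :
    weight (universalMapInt n s p) ≤ 2 ^ ((s + 1) * (2 * s + Fintype.card (USlot n s) ^ 2)) := by
  refine (weight_universalMapInt_le n s p).trans ?_
  have h1 : s + 1 ≤ 2 ^ s := Nat.lt_two_pow_self
  have h2 : Fintype.card (USlot n s) + 1 ≤ 2 ^ Fintype.card (USlot n s) := Nat.lt_two_pow_self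
  calc ((s + 1) * ((s + 1) * (Fintype.card (USlot n s) + 1) ^ Fintype.card (USlot n s))) ^ (s + 1)
      ≤ (2 ^ s * (2 ^ s * (2 ^ Fintype.card (USlot n s)) ^ Fintype.card (USlot n s))) ^ (s + 1) :=
        Nat.pow_le_pow_left (Nat.mul_le_mul h1 (Nat.mul_le_mul h1 (Nat.pow_le_pow_left h2 _))) _
    _ = (2 ^ (2 * s + Fintype.card (USlot n s) ^ 2)) ^ (s + 1) := by
        rw [← pow_mul, ← pow_add, ← pow_add]; congr 2; ring
    _ = 2 ^ ((s + 1) * (2 * s + Fintype.card (USlot n s) ^ 2)) := by rw [← pow_mul, mul_comm]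

/-- **`|f(z)| ≤ wt(f)·(M+1)^{deg f}`** at integer points with `|z_i| ≤ M`.
[cite: Burgisser2000TCS, §2 p. 76] -/
theorem natAbs_eval_le_weight_mul_pow (f : MvPolynomial σ ℤ) (z : σ → ℤ) {M : ℕ}
    (hz : ∀ i, (z i).natAbs ≤ M) :
    (eval z f).natAbs ≤ weight f * (M + 1) ^ f.totalDegree := by
  rw [MvPolynomial.eval_eq, weight, Finset.sum_mul]
  refine (Int.natAbs_sum_le _ _).trans (Finset.sum_le_sum fun m hm => ?_)
  rw [Int.natAbs_mul]
  refine Nat.mul_le_mul_left _ ?_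
  rw [show (∏ i ∈ m.support, z i ^ m i).natAbs = ∏ i ∈ m.support, (z i ^ m i).natAbs from
    map_prod Int.natAbsHom _ _]
  calc ∏ i ∈ m.support, (z i ^ m i).natAbs ≤ ∏ i ∈ m.support, (M + 1) ^ m i :=
        Finset.prod_le_prod (fun _ _ => Nat.zero_le _) fun i _ => by
          rw [Int.natAbs_pow]; exact Nat.pow_le_pow_left ((hz i).trans (Nat.le_succ M)) _
    _ = (M + 1) ^ (m.sum fun _ e => e) := by rw [Finset.prod_pow_eq_pow_sum]; rfl
    _ ≤ (M + 1) ^ f.totalDegree := Nat.pow_le_pow_right (Nat.succ_pos M) (le_totalDegree hm)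

/-- **Entries of the evaluation system are small**: `|∏_p f_p(z)^{α_p}| ≤ (W·(M+1)^D)^{|α|}` when
`wt(f_p) ≤ W`, `deg f_p ≤ D`, `|z_i| ≤ M`. [cite: KumarVolk2022, §6 (proof of Cor. 1.3)] -/
theorem natAbs_prod_eval_pow_le {κ : Type*} (f : κ → MvPolynomial σ ℤ) {W D M : ℕ}
    (hW : ∀ p, weight (f p) ≤ W) (hD : ∀ p, (f p).totalDegree ≤ D) (z : σ → ℤ)
    (hz : ∀ i, (z i).natAbs ≤ M) (α : κ →₀ ℕ) :
    (∏ p ∈ α.support, eval z (f p) ^ α p).natAbs ≤ (W * (M + 1) ^ D) ^ α.degree := by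
  rw [show (∏ p ∈ α.support, eval z (f p) ^ α p).natAbs =
      ∏ p ∈ α.support, (eval z (f p) ^ α p).natAbs from map_prod Int.natAbsHom _ _,
    Finsupp.degree_apply, ← Finset.prod_pow_eq_pow_sum]
  refine Finset.prod_le_prod (fun _ _ => Nat.zero_le _) fun p _ => ?_
  rw [Int.natAbs_pow]
  refine Nat.pow_le_pow_left ?_ _
  exact (natAbs_eval_le_weight_mul_pow (f p) z hz).trans
    (Nat.mul_le_mul (hW p) (Nat.pow_le_pow_right (Nat.succ_pos M) (hD p)))

end Heights

/-! ## The evaluation system: `Q ∘ f = 0` on a grid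

Equivalent presentation of the M1 linear system with rows indexed by GRID POINTS instead of
monomials: `Q ∘ f = 0` iff `Σ_α coeff_α Q · ∏_p f_p(z)^{α_p} = 0` for every `z ∈ {0,…,D}^τ`,
`D ≥ deg(Q ∘ f)` (Alon's Combinatorial Nullstellensatz, `exists_grid_eval_ne_zero'`). For
`f = uFin n` the entry `(z, α) ↦ ∏_p Ũ_p(z)^{α_p}` is a product of integer EVALUATIONS of the
universal map — computable by evaluating the universal circuit numerically, no coefficient
extraction — and has `poly(n)·|α|` bits (`natAbs_evalEntry_uFin_le`); so (P4) of the M1 programme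
reduces to "the entries are polynomial-time computable integers of polynomial bit-size". -/

section EvaluationSystem

variable {σ τ : Type*}

/-- `(Q ∘ f)(z) = Σ_{α ∈ supp Q} coeff_α Q · ∏_p f_p(z)^{α_p}`.
[cite: KumarVolk2022, Lemma 2.1 (proof)] -/
theorem eval_bind₁_eq_sum {R : Type*} [CommSemiring R] (f : σ → MvPolynomial τ R)
    (Q : MvPolynomial σ R) (z : τ → R) :
    eval z (bind₁ f Q) = ∑ α ∈ Q.support, coeff α Q * ∏ p ∈ α.support, eval z (f p) ^ α p := by
  rw [show eval z (bind₁ f Q) = eval (fun p => eval z (f p)) Q from eval₂Hom_bind₁ _ _ _ _,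
    MvPolynomial.eval_eq]

/-- `deg(Q ∘ f) ≤ deg Q · D` when every `f_p` has degree `≤ D`.
[cite: KumarVolk2022, Lemma 2.1 (proof: "maps F[y]_{≤Δ} into F[x]_{≤DΔ}")] -/
theorem totalDegree_bind₁_le {R : Type*} [CommSemiring R] {D : ℕ} (f : σ → MvPolynomial τ R)
    (hf : ∀ p, (f p).totalDegree ≤ D) (Q : MvPolynomial σ R) :
    (bind₁ f Q).totalDegree ≤ Q.totalDegree * D := by
  rw [← aeval_eq_bind₁]
  exact Literature.RingTheory.Nullstellensatz.totalDegree_aeval_le f hf Q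

/-- A nonzero integer polynomial of total degree `≤ D` in finitely many variables has a non-root
in `{0, …, D}^σ` (`exists_grid_eval_ne_zero` for an arbitrary finite index type).
[cite: KumarVolk2022, Lemma 15 (proof: "there exists a_1 ∈ {0,1,…,s} …")] -/
theorem exists_grid_eval_ne_zero' [Finite σ] (P : MvPolynomial σ ℤ) (hP : P ≠ 0) {D : ℕ}
    (hD : P.totalDegree ≤ D) :
    ∃ a : σ → ℤ, (∀ q, 0 ≤ a q ∧ a q ≤ D) ∧ eval a P ≠ 0 := by
  classical
  by_contra h
  push Not at h
  apply hP
  refine eq_zero_of_eval_zero_at_prod_finset P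
    (fun _ => (Finset.range (D + 1)).image (Nat.cast : ℕ → ℤ)) (fun i => ?_) (fun x hx => ?_)
  · rw [Finset.card_image_of_injective _ Nat.cast_injective, Finset.card_range]
    exact lt_of_le_of_lt (degreeOf_le_totalDegree P i) (Nat.lt_succ_of_le hD)
  · refine h x fun q => ?_
    obtain ⟨k, hk, hkx⟩ := Finset.mem_image.1 (hx q)
    rw [← hkx]
    exact ⟨Int.natCast_nonneg k, Int.ofNat_le.2 (Nat.lt_succ_iff.1 (Finset.mem_range.1 hk))⟩

/-- **`Q ∘ f = 0` iff the evaluation system holds on the grid `{0,…,D}^τ`** (`D ≥ deg(Q ∘ f)`):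
rows = grid points `z`, entry `(z, α) = ∏_p f_p(z)^{α_p}`, unknowns `coeff_α Q`.
[cite: KumarVolk2022, §6 (proof of Cor. 1.3: "found by solving a linear system of equations")] -/
theorem bind₁_eq_zero_iff_evalSystem [Finite τ] (f : σ → MvPolynomial τ ℤ) (Q : MvPolynomial σ ℤ)
    {D : ℕ} (hD : (bind₁ f Q).totalDegree ≤ D) :
    bind₁ f Q = 0 ↔ ∀ z : τ → ℤ, (∀ v, 0 ≤ z v ∧ z v ≤ D) →
      ∑ α ∈ Q.support, coeff α Q * ∏ p ∈ α.support, eval z (f p) ^ α p = 0 := by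
  constructor
  · intro h z _
    rw [← eval_bind₁_eq_sum, h, map_zero]
  · intro h
    by_contra hne
    obtain ⟨a, ha, hne'⟩ := exists_grid_eval_ne_zero' _ hne hD
    exact hne' ((eval_bind₁_eq_sum f Q a).trans (h a ha))

/-- `deg (uFin n)_q ≤ S·(s+1)`, `s = corSize n`, `S = |USlot n s|`.
[cite: KumarVolk2022, Thm. 1.2 (proof, §4.2: "the degree of U is at most s'(s+1)")] -/
theorem totalDegree_uFin_le (n : ℕ) (q : Fin (n * n)) :
    (uFin n q).totalDegree ≤ Fintype.card (USlot n (corSize n)) * (corSize n + 1) := by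
  rw [card_uSlot]
  exact totalDegree_universalMapInt_le _ _ _

/-- `wt((uFin n)_q) ≤ 2^{(s+1)(2s+S²)}`, `s = corSize n`, `S = |USlot n s|` — `poly(n)` bits.
[cite: KumarVolk2022, §6 (proof of Cor. 1.3)] -/
theorem weight_uFin_le_two_pow (n : ℕ) (q : Fin (n * n)) :
    weight (uFin n q) ≤
      2 ^ ((corSize n + 1) * (2 * corSize n + Fintype.card (USlot n (corSize n)) ^ 2)) :=
  weight_universalMapInt_le_two_pow _ _ _

/-- ★ **The KV system as an evaluation system**: `Q ∘ Ũ_n = 0` iff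
`Σ_α coeff_α Q · ∏_p Ũ_p(z)^{α_p} = 0` for every grid point `z ∈ {0, …, deg Q · S(s+1)}^{2s}`
(`s = corSize n`, `S = |USlot n s|`). [cite: KumarVolk2022, §6 (proof of Cor. 1.3)] -/
theorem bind₁_uFin_eq_zero_iff_evalSystem (n : ℕ) (Q : MvPolynomial (Fin (n * n)) ℤ) :
    bind₁ (uFin n) Q = 0 ↔
      ∀ z : Fin (corSize n) ⊕ Fin (corSize n) → ℤ,
        (∀ v, 0 ≤ z v ∧
          z v ≤ Q.totalDegree * (Fintype.card (USlot n (corSize n)) * (corSize n + 1))) →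
        ∑ α ∈ Q.support, coeff α Q * ∏ p ∈ α.support, eval z (uFin n p) ^ α p = 0 :=
  bind₁_eq_zero_iff_evalSystem _ _ (totalDegree_bind₁_le _ (totalDegree_uFin_le n) Q)

/-- ★ **Entries of the KV evaluation system have polynomial bit-size**:
`|∏_p Ũ_p(z)^{α_p}| ≤ 2^{(B + M·D)·|α|}` for `|z_v| ≤ M`, with `B = (s+1)(2s+S²)` and
`D = S(s+1)` (`s = corSize n ≤ n²/200`, `S = |USlot n s|`). [cite: KumarVolk2022, §6 (proof of Cor. 1.3)] -/
theorem natAbs_evalEntry_uFin_le (n : ℕ) {M : ℕ} (z : Fin (corSize n) ⊕ Fin (corSize n) → ℤ)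
    (hz : ∀ v, (z v).natAbs ≤ M) (α : Fin (n * n) →₀ ℕ) :
    (∏ p ∈ α.support, eval z (uFin n p) ^ α p).natAbs ≤
      2 ^ (((corSize n + 1) * (2 * corSize n + Fintype.card (USlot n (corSize n)) ^ 2) +
        M * (Fintype.card (USlot n (corSize n)) * (corSize n + 1))) * α.degree) := by
  set B := (corSize n + 1) * (2 * corSize n + Fintype.card (USlot n (corSize n)) ^ 2) with hB
  set D := Fintype.card (USlot n (corSize n)) * (corSize n + 1) with hD
  refine (natAbs_prod_eval_pow_le (uFin n) (weight_uFin_le_two_pow n) (totalDegree_uFin_le n)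
    z hz α).trans ?_
  have hM : (M + 1) ^ D ≤ 2 ^ (M * D) :=
    calc (M + 1) ^ D ≤ (2 ^ M) ^ D := Nat.pow_le_pow_left Nat.lt_two_pow_self _
      _ = 2 ^ (M * D) := (pow_mul 2 M D).symm
  calc (2 ^ B * (M + 1) ^ D) ^ α.degree ≤ (2 ^ B * 2 ^ (M * D)) ^ α.degree :=
        Nat.pow_le_pow_left (Nat.mul_le_mul_left _ hM) _
    _ = 2 ^ ((B + M * D) * α.degree) := by rw [← pow_add, ← pow_mul]

end EvaluationSystem

end KumarVolk2020

end Literature.Computability.AlgebraicComplexity
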